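import Summits.BirchSwinnertonDyer.BirchSwinnertonDyer.Theorems.AdditiveKolyvaginRoadLevelKolyvaginSystemsAdditiveOnGammaAvatarLocus
import Summits.BirchSwinnertonDyer.BirchSwinnertonDyer.Theorems.ErratumRoadFiveX11aLowerHalfRamCongruence
import Summits.BirchSwinnertonDyer.BirchSwinnertonDyer.Theorems.ErratumRoadFiveNonSurjCornerTamagawaExponent
import Summits.BirchSwinnertonDyer.BirchSwinnertonDyer.Theorems.KimAtThreeKolyvaginIsogenyTransport
import Literature.NumberTheory.EllipticCurves.ShortWeierstrassGoodTwistLocalProofs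
import Literature.NumberTheory.DiophantineGeometry.ConductorMultiplicativeProofs
import Literature.NumberTheory.EllipticCurves.LocalTorsionMultiplicativeProofs
import Literature.NumberTheory.EllipticCurves.RootNumberTwistProofs
import HarnessLib

/-!
# Route `AdditiveKolyvaginRoad`, crux KS′ `LevelKolyvaginSystemsAdditive` (item stmt-BirchSwinnertonDyer-21396):
# THE (γ)-AVATAR LOCUS IS SLIM — six of the avatar clauses of the line result p616119 are AUTOMATIC
# (cell `pub/bsd-wall`, width seat `bsd-wall-akr-p2x-w2` g5; `--supports stmt-BirchSwinnertonDyer-21396`, helper)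

WHAT. The landed result of line `epsilon_matched_retyping`,
`AdditiveKoly.levelKolyvaginSystemsAdditive_onGammaAvatarLocus` (p616119), proves KS′'s conclusion at every ♯ additive frame
`(E, p, K, Dt, β, ι)` carrying a (γ)-AVATAR `E₀` (hypothesis `hav`, an ∃-clause of some twenty conjuncts), GRANTED seven refereed
named facts.  This file shows that SIX of those conjuncts follow from the others and from the frame, by tree theorems only:

* `hs₀`  — `ρ̄_{E₀,p}` onto: surjectivity is an invariant of the `Γ_ℚ`-module `E[p] ≃ E₀[p]`
  (`KimAtThreeKolyvaginIsogenyTransport.hasSurjectiveModNGaloisRep_iff_of_torsionAddEquiv`);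
* `hsp₀` — Hypothesis ♠(1) for `E₀` (`p ∤ ord_ℓ Δ_min(E₀)` at every multiplicative `ℓ`): Serre's `n° 1.12` read both ways along the
  torsion isomorphism at the place over `ℓ ≠ p` (`RamCongruence.exists_smul_ne_of_mult_of_not_dvd` ∕ `smul_eq_of_mult_of_dvd` ∕
  `smul_eq_of_good` ∕ `eq_zero_of_fixed_of_additive`, `p ≥ 5`) — the per-prime form of `RamCongruence.ram_of_torsionIso`;
* `htam₀` — `p ∤ ∏ c_ℓ(E₀)`: for `p ≥ 5` a prime divides the Tamagawa product iff it divides `ord_v Δ_min` at a SPLIT multiplicative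
  place (`CornerLocal.not_dvd_tamagawaProduct_iff_forall`), so ♠(1) already forbids it — for ANY curve; in particular the crux's own
  frame binder `¬ p ∣ W.tamagawaProduct` is implied by its binder ♠(1) (`not_dvd_tamagawaProduct_of_spadeOne`, §1);
* `htype` — same multiplicative primes: `ℓ ∥ N` iff multiplicative at `ℓ` (Silverman *ATAEC* IV.10.2 (b), `conductorExponent_eq_one_iff_holds`)
  and `N = N₀ p²` with neither curve multiplicative at `p` (`Addv E p`; `E₀` good at `p`);
* `hrad` — `rad(pN) = rad(pN₀)`: arithmetic from `N = N₀ p²`;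
* `hH₀`  — the Heegner hypothesis for `N₀ ∣ N` (`SatisfiesHeegnerHypothesis.of_dvd`).

RESULT. `levelKolyvaginSystemsAdditive_onGammaAvatarLocus_slim`: the line result RESTATED with the slim locus clause — a `p`-good
ORDINARY NON-ANOMALOUS `E₀/ℚ` with a `Γ_ℚ`-equivariant `E[p] ≃ E₀[p]`, `N₀ p² = N`, the same global root number, Heegner
parametrisation data `(Dt₀, β₀)` with `4N₀ ∣ β₀² − d_K`, `p ∤ c₀`, and the log certificate — GRANTED the same seven named facts
(hypotheses; the gate records conditional-result).  Proof = the six derivations + p616119 by name.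

HONEST FRAMING: theorems only; 0 definitions, 0 named facts, 0 `sorry`; closes nothing by itself (the residual stub S1
`stub_offAvatarLocus` — KS′ off the locus — is untouched).  BSD is not proved by any of this; KS′ (∀ frames) is not proved by any of this.

References: [cite: SerreInventiones1972, §1.11–1.12] [cite: SilvermanATAEC1994, IV.10.2 (b), Cor. IV.9.2 (d), Table 4.1, Ex. 5.13]
[cite: SilvermanAEC2009, VII.5 Prop. 5.1, C.16] [cite: GrossLMS1991, §1 (Heegner hypothesis)] [cite: WZhang2014, Notations (v), §3]
[cite: KrizLi2019, Thm. 1.16].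
-/

set_option linter.dupNamespace false
set_option autoImplicit false

noncomputable section

open scoped Classical

open WeierstrassCurve NumberField IsDedekindDomain Field IsDedekindDomain.HeightOneSpectrum Rat.HeightOneSpectrum
  Literature.NumberTheory.EllipticCurves Literature.NumberTheory.EllipticCurves.ModularForms
  Literature.NumberTheory.EllipticCurves.Rank1Residual Literature.NumberTheory.GaloisRepresentations
  Literature.NumberTheory.GaloisCohomology
  Summit.BirchSwinnertonDyer.BirchSwinnertonDyer.Theses.AdditiveKolyvaginRoad
  Summit.BirchSwinnertonDyer.Rank1Residual

namespace Summit.BirchSwinnertonDyer.BirchSwinnertonDyer.Theorems.AdditiveKoly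

/-! ## §1 ♠(1) and `p ≥ 5` imply `p ∤ ∏ c_ℓ` -/

/-- **Hypothesis ♠(1) makes the Tamagawa binder automatic (`p ≥ 5`).**  For a globally minimal elliptic `W/ℚ` and a prime
`p ≥ 5`: if `p ∤ ord_ℓ(Δ_min)` at every prime `ℓ` of multiplicative reduction, then `p ∤ ∏_ℓ c_ℓ(W)`.  Indeed for `p ≥ 5`,
`p ∣ ∏ c_ℓ` iff `p ∣ ord_v(Δ_min) = c_v` at some SPLIT multiplicative place (`c_v ≤ 4` elsewhere: Kodaira–Néron,
`CornerLocal.not_dvd_tamagawaProduct_iff_forall`).  So in the crux frame the binder `¬ p ∣ W.tamagawaProduct` is implied by ♠(1).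
[cite: SilvermanATAEC1994, Cor. IV.9.2 (d) and Table 4.1] -/
theorem not_dvd_tamagawaProduct_of_spadeOne (W : WeierstrassCurve ℚ) [W.IsElliptic] [W.IsGloballyMinimal]
    (p : ℕ) [Fact p.Prime] (hp : 5 ≤ p)
    (hsp : ∀ (ℓ : ℕ) [Fact ℓ.Prime], W.HasMultiplicativeReductionAtPrime ℓ →
      ¬ p ∣ padicValInt ℓ W.minimalDiscriminantInt) :
    ¬ p ∣ W.tamagawaProduct := by
  rw [CornerLocal.not_dvd_tamagawaProduct_iff_forall W p hp]
  intro v hs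
  haveI : Fact (primesEquiv v : ℕ).Prime := ⟨(primesEquiv v).2⟩
  have hm : W.HasMultiplicativeReductionAtPrime (primesEquiv v : ℕ) :=
    (W.hasMultiplicativeReductionAtPrime_iff_hasMultiplicativeReductionAt_ringOfIntegers v).mpr
      hs.hasMultiplicativeReductionAt
  rw [CornerLocal.ordMinimalDiscriminant_eq_padicValInt_primesEquiv W v]
  exact hsp _ hm

/-! ## §2 What the frame and the torsion isomorphism give the avatar for free -/

/-- **`ℓ ∥ N_W` iff `W` is multiplicative at `ℓ`** (Silverman *ATAEC* IV.10.2 (b): `f_ℓ = 1` exactly at multiplicative primes;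
tree `conductorExponent_eq_one_iff_holds` + `factorization_conductorNorm_eq_conductorExponent`, read prime-indexed).
[cite: SilvermanATAEC1994, IV.10.2 (b)] -/
theorem hasMultiplicativeReductionAtPrime_iff_factorization_conductorNorm_eq_one (V : WeierstrassCurve ℚ) [V.IsElliptic]
    (ℓ : ℕ) [hℓ : Fact ℓ.Prime] :
    V.HasMultiplicativeReductionAtPrime ℓ ↔ (V.conductorNorm ℤ).factorization ℓ = 1 := by
  obtain ⟨v, hv⟩ : ∃ v : HeightOneSpectrum (𝓞 ℚ), (primesEquiv v : ℕ) = ℓ :=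
    ⟨primesEquiv.symm ⟨ℓ, hℓ.out⟩, by rw [Equiv.apply_symm_apply]⟩
  subst hv
  have e1 := V.hasMultiplicativeReductionAtPrime_iff_hasMultiplicativeReductionAt_ringOfIntegers v
  have e2 : V.conductorExponent v = 1 ↔ V.HasMultiplicativeReductionAt v := conductorExponent_eq_one_iff_holds v V
  have e3 := factorization_conductorNorm_eq_conductorExponent V (primesEquiv v)
  rw [Equiv.symm_apply_apply] at e3
  rw [e3]
  exact e1.trans e2.symm

/-- **Same multiplicative primes from `N = N₀ p²`.**  If `N_{W₀} · p² = N_W` and neither curve is multiplicative at `p`, then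
`W` and `W₀` have the same primes of multiplicative reduction (`f_ℓ(N) = f_ℓ(N₀)` for `ℓ ≠ p`, and `f_ℓ = 1` iff multiplicative).
[cite: SilvermanATAEC1994, IV.10.2 (b)] -/
theorem hasMultiplicativeReductionAtPrime_iff_of_conductorNorm_eq (W W₀ : WeierstrassCurve ℚ) [W.IsElliptic] [W₀.IsElliptic]
    [NeZero (W₀.conductorNorm ℤ)] (p : ℕ) [hp : Fact p.Prime]
    (hN : W₀.conductorNorm ℤ * p ^ 2 = W.conductorNorm ℤ)
    (hW : ¬ W.HasMultiplicativeReductionAtPrime p) (hW₀ : ¬ W₀.HasMultiplicativeReductionAtPrime p)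
    (ℓ : ℕ) [hℓ : Fact ℓ.Prime] :
    W.HasMultiplicativeReductionAtPrime ℓ ↔ W₀.HasMultiplicativeReductionAtPrime ℓ := by
  by_cases hℓp : ℓ = p
  · subst hℓp
    exact ⟨fun h ↦ (hW h).elim, fun h ↦ (hW₀ h).elim⟩
  have hfac : (W.conductorNorm ℤ).factorization ℓ = (W₀.conductorNorm ℤ).factorization ℓ := by
    rw [← hN, Nat.factorization_mul (NeZero.ne _) (pow_ne_zero _ hp.out.ne_zero), Finsupp.add_apply,
      Nat.factorization_pow, Finsupp.smul_apply, hp.out.factorization, Finsupp.single_apply, if_neg (Ne.symm hℓp),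
      smul_zero, add_zero]
  rw [hasMultiplicativeReductionAtPrime_iff_factorization_conductorNorm_eq_one W ℓ,
    hasMultiplicativeReductionAtPrime_iff_factorization_conductorNorm_eq_one W₀ ℓ, hfac]

/-- **Hypothesis ♠(1) passes to a `p`-congruent curve, prime by prime (`p ≥ 5`).**  Let `W, W₀/ℚ` be globally minimal elliptic
curves with a `Γ_ℚ`-equivariant `e : W[p] ≃ W₀[p]`, `p ≥ 5`, and `ℓ ≠ p` a prime of multiplicative reduction of `W` with
`p ∤ ord_ℓ Δ_min(W)`.  Then `W₀` is multiplicative at `ℓ` and `p ∤ ord_ℓ Δ_min(W₀)`.  (Serre 1972 n° 1.12 both ways: `W[p]` is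
ramified at `ℓ` with a non-zero inertia-fixed vector; transported along `e` this excludes good (unramified) and additive (no fixed
vector for `p ≥ 5`) reduction of `W₀` at `ℓ`, and `p ∣ ord_ℓ Δ_min(W₀)` would make `W₀[p]` unramified.  The ∃-packaged form is the
tree's `RamCongruence.ram_of_torsionIso`.) [cite: SerreInventiones1972, §1.11–1.12] [cite: SilvermanATAEC1994, Ex. 5.13 (a)(b)] -/
theorem hasMultiplicativeReductionAtPrime_and_not_dvd_of_torsionIso (W W₀ : WeierstrassCurve ℚ) [W.IsElliptic]
    [W.IsGloballyMinimal] [W₀.IsElliptic] [W₀.IsGloballyMinimal] (p : ℕ) [hp : Fact p.Prime] (hp5 : 5 ≤ p)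
    (e : geomTorsion W (p : ℤ) ≃+ geomTorsion W₀ (p : ℤ))
    (he : ∀ (σ : absoluteGaloisGroup ℚ) (P : geomTorsion W (p : ℤ)), e (σ • P) = σ • e P)
    (ℓ : ℕ) [hℓ : Fact ℓ.Prime] (hℓp : ℓ ≠ p) (hWℓ : W.HasMultiplicativeReductionAtPrime ℓ)
    (hnd : ¬ p ∣ padicValInt ℓ W.minimalDiscriminantInt) :
    W₀.HasMultiplicativeReductionAtPrime ℓ ∧ ¬ p ∣ padicValInt ℓ W₀.minimalDiscriminantInt := by
  obtain ⟨v, hv⟩ : ∃ v : HeightOneSpectrum (𝓞 ℚ), (primesEquiv v : ℕ) = ℓ :=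
    ⟨primesEquiv.symm ⟨ℓ, hℓ.out⟩, by rw [Equiv.apply_symm_apply]⟩
  subst hv
  have hpv : (p : 𝓞 ℚ) ∉ v.asIdeal := RamCongruence.natCast_not_mem_of_ne v (primesEquiv v).2 rfl hℓp
  have hmult : W.HasMultiplicativeReductionAt v :=
    (W.hasMultiplicativeReductionAtPrime_iff_hasMultiplicativeReductionAt_ringOfIntegers v).mp hWℓ
  have hnd' : ¬ p ∣ W.ordMinimalDiscriminant v := by
    rwa [CornerLocal.ordMinimalDiscriminant_eq_padicValInt_primesEquiv W v]
  -- `W[p]` is ramified at `v` and has a non-zero inertia-fixed vector; transport both along `e`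
  have hram := RamCongruence.exists_smul_ne_of_torsionIso v e he
    (RamCongruence.exists_smul_ne_of_mult_of_not_dvd W v hpv hmult hnd')
  have hfix := RamCongruence.exists_fixed_ne_zero_of_torsionIso v e he
    (RamCongruence.exists_fixed_ne_zero_of_mult W v hpv hmult)
  -- hence `W₀` is multiplicative at `v`
  have hm : W₀.HasMultiplicativeReductionAt v := by
    rcases W₀.hasGoodReductionAt_or_hasMultiplicativeReductionAt_or_hasAdditiveReductionAt v with hg | hm | ha
    · exfalso
      obtain ⟨τ, hτ, P, hP⟩ := hram
      exact hP (RamCongruence.smul_eq_of_good W₀ v hpv hg hτ P)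
    · exact hm
    · exfalso
      obtain ⟨P, hP0, hP⟩ := hfix
      exact hP0 (RamCongruence.eq_zero_of_fixed_of_additive W₀ v hp5 hpv ha P hP)
  refine ⟨(W₀.hasMultiplicativeReductionAtPrime_iff_hasMultiplicativeReductionAt_ringOfIntegers v).mpr hm, fun hdvd ↦ ?_⟩
  rw [← CornerLocal.ordMinimalDiscriminant_eq_padicValInt_primesEquiv W₀ v] at hdvd
  obtain ⟨τ, hτ, P, hP⟩ := hram
  exact hP (RamCongruence.smul_eq_of_mult_of_dvd W₀ v hpv hm hdvd hτ P)

/-- `rad(p N₀ p²) = rad(p N₀)`: the primes dividing `p · (N₀ p²)` are those dividing `p · N₀`. [folklore] -/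
theorem prime_dvd_mul_iff_of_mul_sq_eq {N N₀ p : ℕ} (hN : N₀ * p ^ 2 = N) (q : ℕ) (hq : q.Prime) :
    q ∣ p * N ↔ q ∣ p * N₀ := by
  subst hN
  constructor
  · intro h
    rcases hq.dvd_mul.mp h with h | h
    · exact dvd_mul_of_dvd_left h _
    · rcases hq.dvd_mul.mp h with h | h
      · exact dvd_mul_of_dvd_right h _
      · exact dvd_mul_of_dvd_left (hq.dvd_of_dvd_pow h) _
  · intro h
    exact h.trans ⟨p ^ 2, by ring⟩

/-! ## §3 The line result on the slim locus -/

/-- **KS′ ON THE SLIM (γ)-AVATAR LOCUS, modulo refereed named facts.**  The statement of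
`levelKolyvaginSystemsAdditive_onGammaAvatarLocus` (p616119) with the avatar clause reduced to its independent conjuncts: a
`Γ_ℚ`-equivariant `E[p] ≃ E₀[p]` with `E₀` globally minimal, `p`-good ORDINARY and NON-ANOMALOUS, `N₀ p² = N`, the same global
root number, Heegner parametrisation data `(Dt₀, β₀)` with `4N₀ ∣ β₀² − d_K` and `p ∤ c₀`, and the log certificate.  The dropped
conjuncts — `ρ̄_{E₀,p}` onto, ♠(1) for `E₀`, `p ∤ ∏ c_ℓ(E₀)`, same multiplicative primes, `rad(pN) = rad(pN₀)`, the Heegner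
hypothesis for `N₀` — are derived in §§1–2.  Conditional on the seven displayed named facts exactly as p616119; closes nothing.
[cite: WZhang2014, Notations (v), §3.9 (3.30), Thm. 4.3, §8.1] [cite: KrizLi2019, Thm. 1.16] [cite: SerreInventiones1972, §1.12]
[cite: SilvermanATAEC1994, IV.10.2 (b), Cor. IV.9.2 (d)] -/
theorem levelKolyvaginSystemsAdditive_onGammaAvatarLocus_slim
    (hDD : ∀ (V : WeierstrassCurve ℚ) [V.IsElliptic] (q : ℕ) [Fact q.Prime], p_parity V q)
    (hCT : WeierstrassCurve.exists_casselsTate_pairing (K := ℚ)) (hPT : poitouTate_selmerStructure_duality ℚ)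
    (hKL : KrizLi2019.thm116_padicLogHeegner_congruence) (hPUB : PublishedInputsAdditiveKoly) (hDual : PublishedDualityInputsAdditiveKoly)
    (hZ : WZhang2014.exists_levelRaisedBipartiteSystem)
    (W : WeierstrassCurve ℚ) [W.IsElliptic] [W.IsGloballyMinimal] [NeZero (W.conductorNorm ℤ)]
    (p : ℕ) [Fact p.Prime] (K : Type) [Field K] [NumberField K]
    (Dt : ModularParametrizationData W (W.conductorNorm ℤ)) (β : ℤ) (ι : K →+* ℂ)
    (hp : 5 ≤ p) (hadd : Addv W p) (hs : W.HasSurjectiveModNGaloisRep p)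
    (hsp : ∀ (ℓ : ℕ) [Fact ℓ.Prime], W.HasMultiplicativeReductionAtPrime ℓ → ¬ p ∣ padicValInt ℓ W.minimalDiscriminantInt)
    (htwo : ∃ (ℓ₁ ℓ₂ : ℕ) (_ : Fact ℓ₁.Prime) (_ : Fact ℓ₂.Prime), ℓ₁ ≠ ℓ₂ ∧
      W.HasMultiplicativeReductionAtPrime ℓ₁ ∧ W.HasMultiplicativeReductionAtPrime ℓ₂)
    (htam : ¬ p ∣ W.tamagawaProduct) (hr : W.analyticRank = 1) (hK : IsImaginaryQuadratic K) (hodd : Odd (NumberField.discr K))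
    (hlt : NumberField.discr K < -4) (hH : SatisfiesHeegnerHypothesis (W.conductorNorm ℤ) K)
    (hL : (W.quadraticTwist (NumberField.discr K : ℚ)).entireLFunction 1 ≠ 0)
    (hβ : (4 * (W.conductorNorm ℤ : ℤ)) ∣ β ^ 2 - NumberField.discr K) (hc : ¬ (p : ℤ) ∣ Dt.c)
    (hav : ∃ (W₀ : WeierstrassCurve ℚ) (_ : W₀.IsElliptic) (_ : W₀.IsGloballyMinimal) (_ : NeZero (W₀.conductorNorm ℤ))
      (Dt₀ : ModularParametrizationData W₀ (W₀.conductorNorm ℤ)) (β₀ : ℤ)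
      (e : geomTorsion W (p : ℤ) ≃+ geomTorsion W₀ (p : ℤ)),
      (∀ (σ : absoluteGaloisGroup ℚ) (P : geomTorsion W (p : ℤ)), e (σ • P) = σ • e P) ∧
      IsOrdinaryAt W₀ p ∧ ¬ (p : ℤ) ∣ W₀.frobeniusTrace p - 1 ∧
      W₀.conductorNorm ℤ * p ^ 2 = W.conductorNorm ℤ ∧ W₀.rootNumber = W.rootNumber ∧
      (4 * (W₀.conductorNorm ℤ : ℤ)) ∣ β₀ ^ 2 - NumberField.discr K ∧ ¬ (p : ℤ) ∣ Dt₀.c ∧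
      ∃ (ιp : K →+* ℚ_[p]) (H₀ : HeegnerDatum (W₀.conductorNorm ℤ) (NumberField.discr K))
        (y₀ : (W₀.baseChange K).toAffine.Point),
        H₀.β = β₀ ∧ WeierstrassCurve.Affine.Point.map ι.toRatAlgHom y₀ = heegnerPointComplex Dt₀ H₀ ∧
          ¬ ∃ Q : (W₀.baseChange ℚ_[p]).toAffine.Point, (p : ℤ) • Q = X11b.padicPointOf W₀ p ιp y₀) :
    ∀ (c : K ≃ₐ[ℚ] K), c ≠ 1 → ∀ [Module (ZMod p) (Vp W K p)], Nonempty (LevelKolyvaginSystemP W K p Dt β ι c) := by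
  obtain ⟨W₀, _, _, _, Dt₀, β₀, e, he, hord, hna, hN, hroot, hβ₀, hc₀, ιp, hcert⟩ := hav
  -- neither curve is multiplicative at `p`: `W` is additive there, `W₀` is good there
  have hWp : ¬ W.HasMultiplicativeReductionAtPrime p := hadd.2
  have hW₀p : ¬ W₀.HasMultiplicativeReductionAtPrime p := fun h ↦
    (WeierstrassCurve.HasMultiplicativeReduction.not_hasGoodReduction (R := ℤ_[p]) h) hord.1
  -- same multiplicative primes (conductor), ♠(1) for `E₀` (Serre), surjectivity (torsion iso), Tamagawa (§1)
  have htype : ∀ (ℓ : ℕ) [Fact ℓ.Prime], W.HasMultiplicativeReductionAtPrime ℓ ↔ W₀.HasMultiplicativeReductionAtPrime ℓ :=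
    fun ℓ _ ↦ hasMultiplicativeReductionAtPrime_iff_of_conductorNorm_eq W W₀ p hN hWp hW₀p ℓ
  have hsp₀ : ∀ (ℓ : ℕ) [Fact ℓ.Prime], W₀.HasMultiplicativeReductionAtPrime ℓ →
      ¬ p ∣ padicValInt ℓ W₀.minimalDiscriminantInt := by
    intro ℓ _ h₀
    have hWℓ : W.HasMultiplicativeReductionAtPrime ℓ := (htype ℓ).mpr h₀
    have hℓp : ℓ ≠ p := by
      rintro rfl
      exact hWp hWℓ
    exact (hasMultiplicativeReductionAtPrime_and_not_dvd_of_torsionIso W W₀ p hp e he ℓ hℓp hWℓ (hsp ℓ hWℓ)).2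
  have hs₀ : W₀.HasSurjectiveModNGaloisRep p :=
    (KimAtThreeKolyvaginIsogenyTransport.hasSurjectiveModNGaloisRep_iff_of_torsionAddEquiv e he).mp hs
  have htam₀ : ¬ p ∣ W₀.tamagawaProduct := not_dvd_tamagawaProduct_of_spadeOne W₀ p hp hsp₀
  -- radical and Heegner hypothesis from `N = N₀ p²`
  have hrad : ∀ q : ℕ, q.Prime → (q ∣ p * W.conductorNorm ℤ ↔ q ∣ p * W₀.conductorNorm ℤ) :=
    fun q hq ↦ prime_dvd_mul_iff_of_mul_sq_eq hN q hq
  have hH₀ : SatisfiesHeegnerHypothesis (W₀.conductorNorm ℤ) K := SatisfiesHeegnerHypothesis.of_dvd (Dvd.intro _ hN) hH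
  exact levelKolyvaginSystemsAdditive_onGammaAvatarLocus hDD hCT hPT hKL hPUB hDual hZ W p K Dt β ι hp hadd hs hsp htwo htam hr hK
    hodd hlt hH hL hβ hc ⟨W₀, ‹_›, ‹_›, ‹_›, Dt₀, β₀, e, he, hord, hna, hs₀, hsp₀, htam₀, hrad, hN, htype, hroot, hH₀, hβ₀, hc₀,
      ιp, hcert⟩

end Summit.BirchSwinnertonDyer.BirchSwinnertonDyer.Theorems.AdditiveKoly

end
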